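import Summits.CriticalPhenomena.PercolationContinuityZ3.Theorems.PercNearOneGluingNoHeavyQuantGluedChildrenForest
import Summits.CriticalPhenomena.PercolationContinuityZ3.Theorems.PercNearOneGluingNoHeavyQuantThreeChainPieces
import HarnessLib

/-!
# QUANT lane R8, T-DEC: EVERY FOREST OF 3-CHAINS `R[q₁](R[p₁](R[t₁])) ⊔ … ⊔ R[q_k](R[p_k](R[t_k]))` (`mᵢ = qᵢ(1+pᵢ+pᵢtᵢ) ≥ 2`, `0 < tᵢ ≤ 1`;
# `tᵢ = 1` is the GLUED CHILD `R[qᵢ](R²[pᵢ])`, so mixed forests are included), EVERY WIDTH `k`, IS SDEC AT EVERY FLOOR `x ≤ min qᵢpᵢtᵢ` —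
# ORACLE-FREE (census-1 gen 31; the k-general form of census-1 g30's `sdec_chains3` / `sdec_gluedChildren3`)

builds on p205010 (kernel theorem, internal audit signed; external expert review pending)

Support file (`--supports stmt-CriticalPhenomena-4575`), QUANT lane seat prim-quant-census-1 (gen 31); memo
`run/shared/lean/prim/quant/prim-quant-census-1/g31/HUB-GENERAL-G31.md`.  Theorems only (no definitions), standard axioms, no sorries.  Uses the hub of
every width (`sdec_cHub`, g31), the glued-children expansion tools (`hubForest_piece`, `farPieces_sum_bounds`, g31 `…QuantGluedChildrenForest`), census-1
g30's 3-chain pieces (`gate_chain3_eq_mix`, `chain3_params`, `chain3_laws`, `hp_laws`, `isHigh_hp`, `isHigh_farPieceHp`, `sdec_chain3`,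
`…QuantThreeChainPieces`), arm-1 g57's HIGH-CONV `sdec_lconv_high`, `isHigh_sdec` (census-1 g29), `sdec_farPieceBlob`, `sdec_blob3_step`, `sdec_mix_laws`.

THE FAMILY.  A 3-chain `R[q](R[p](R[t]))` is the sibling `gate {1: 1−p, 2: p(1−t), 3: pt} q`; with `m = q(1+p+pt) > 2` at floors above `(m−1)/2` it is
heavy-unfloored (RATE-PLAN §57.3's worked example `R[.9](R[.889](R[.9375]))`) — the residue's minimal open FAMILY; widths 2, 3: census-1 g30
(`sdec_chains2`, `sdec_chains3`); its closure `t → 1` is the glued-children family (`…QuantGluedChildrenForest`).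

THE PROOF = the k-fold piece expansion with THREE piece types.  `gate CH q = α·blob₃(m/3) + (1−α)·(β′·C((m−1)/2) + (1−β′)·H(m−2))`
(`gate_chain3_eq_mix`; `H(θ) = {2,3;θ}` the LIGHT piece, HIGH by `isHigh_hp`), so `cHub P ∗ flaw (s :: L)` is the two-level same-mean mixture of
`G ∗ blob₃`, `cHub (γ :: P) ∗ flaw L` and `G ∗ H` (`G = cHub P ∗ flaw L`).
* **`threeChain_inv`** — the invariant of `…QuantGluedChildrenForest` with a FOURTH clause: `G ∗ H(θ)` is SDEC for every light piece `0 ≤ θ ≤ 1`,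
  `3x ≤ 2 + θ` (HIGH-CONV `sdec_lconv_high` off the corner; in the corner `|P| = 1 ∧ L = []` the term `C(γ) ∗ H(θ)` is itself HIGH,
  `isHigh_farPieceHp`); the corner `P = [] ∧ L = []` of clause (2) is `sdec_chain3`.
* **`sdec_threeChain_forest`** — `∀ L`, every sibling a 3-chain with `0 < qᵢ, pᵢ < 1`, `0 < tᵢ ≤ 1`, `mᵢ ≥ 2` and `x ≤ qᵢpᵢtᵢ`, `0 < x` ⟹
  **`SDEC x (ftop L) (flaw L)`**; at `tᵢ = 1` the sibling law `{1: 1−p, 2: p(1−t), 3: pt}` is the glued child's `C(p)` (the corner uses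
  `sdec_gluedChild`), so forests MIXING 3-chains and glued children are covered.  `threeChains_ftop_fmean`: `ftop L = 3k`, `x·ftop L ≤ fmean L`.

HONEST STATUS.  An unconditional SDEC family of every width inside the heavy-unfloored residue; `SiblingStep` (all tree-OK forests), `GluedDominated`, `SDECConvClosed`, `FarTreeRow` OPEN; RATE
class (log\*) / honest sentence of `run/shared/lean/prim/quant/README.md` unchanged.  [this work].  Nothing here is cited as a published result.  The
gluing rows served [cite: KozmaNitzan2024, Conjecture 3 (p. 15)]; product measure [cite: Grimmett1999, §1.3 p. 10].
-/

noncomputable section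

open scoped BigOperators

namespace Summit.CriticalPhenomena.PercolationContinuityZ3.Theorems
namespace Quant
namespace LawDec

open Finset

/-- the point mass `δ_K` -/
local notation3 "δ[" K "]" => (fun k : ℕ => if k = (K : ℕ) then (1 : ℝ) else 0)

/-- the FAR-GIANT PIECE `C(γ) = {1, 3; γ}` -/
local notation3 "CP[" a "]" => (fun h : ℕ => (1 - (a : ℝ)) * (if h = 1 then (1 : ℝ) else 0) + (a : ℝ) * (if h = 3 then (1 : ℝ) else 0))

/-- the LIGHT PIECE `{2, 3; θ}` of a gated 3-chain -/
local notation3 "HP[" a "]" => (fun h : ℕ => (1 - (a : ℝ)) * (if h = 2 then (1 : ℝ) else 0) + (a : ℝ) * (if h = 3 then (1 : ℝ) else 0))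

/-- the 3-chain's sub-forest law `{1: 1−p, 2: p(1−s), 3: ps}` -/
local notation3 "CH[" p ", " s "]" => (fun h : ℕ => (1 - (p : ℝ)) * (if h = 1 then (1 : ℝ) else 0) +
  (p : ℝ) * (1 - (s : ℝ)) * (if h = 2 then (1 : ℝ) else 0) + (p : ℝ) * (s : ℝ) * (if h = 3 then (1 : ℝ) else 0))

/-- the SUB-FLOOR PART of a gated 3-chain (as in `…QuantThreeChainPieces`) -/
local notation3 "NP[" q ", " p ", " s "]" => (fun h : ℕ =>
  2 * (1 - (p : ℝ)) / (2 - p - p * s) * CP[((q : ℝ) * (1 + p + p * s) - 1) / 2] h +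
  (p : ℝ) * (1 - s) / (2 - p - p * s) * HP[(q : ℝ) * (1 + p + p * s) - 2] h)

/-- `ftop` and `fmean` of a list of 3-chains: `ftop = 3·length`, `x·ftop ≤ fmean`. [this work] -/
theorem threeChains_ftop_fmean {x : ℝ} : ∀ L : List Sib,
    (∀ s ∈ L, s.M = 3 ∧ 0 < s.q ∧ s.q < 1 ∧ ∃ p t : ℝ, 0 < p ∧ p < 1 ∧ 0 < t ∧ t ≤ 1 ∧ s.ρ = CH[p, t] ∧
      2 ≤ s.q * (1 + p + p * t) ∧ x ≤ s.q * (p * t)) →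
    ftop L = 3 * L.length ∧ x * (ftop L : ℝ) ≤ fmean L
  | [], _ => by simp [ftop, fmean]
  | s :: L, hL => by
    obtain ⟨hM, hq0, _, p, t, hp0, hp1, ht0, ht1, hρ, _, hx⟩ := hL s (by simp)
    obtain ⟨ih1, ih2⟩ := threeChains_ftop_fmean L (fun s' h' => hL s' (List.mem_cons_of_mem s h'))
    have hmean : s.mean = 1 + p + p * t := by
      unfold Sib.mean; rw [hM, hρ]; exact (chain3_laws hq0.le (hL s (by simp)).2.2.1.le hp0.le hp1.le ht0.le ht1).1.2.2.2
    simp only [ftop, fmean, List.length_cons, hM, hmean]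
    refine ⟨by rw [ih1]; ring, ?_⟩
    push_cast
    have : 0 ≤ s.q * (1 + p - 2 * p * t) := mul_nonneg hq0.le (by nlinarith)
    nlinarith [ih2, hx, this]

/-- **THE INVARIANT** of the k-fold piece expansion for 3-chains.  `G = cHub P ∗ flaw L`: (1) law facts; (2) SDEC unless `|P| = 1 ∧ L = []`;
(3) `G ∗ blob₃(θ)` SDEC for big heavy blobs; (4) `G ∗ {2,3;θ}` SDEC for every light piece `0 ≤ θ ≤ 1`, `3x ≤ 2 + θ`. [this work] -/
theorem threeChain_inv {x : ℝ} (hx0 : 0 < x) (hx1 : x < 1) : ∀ L : List Sib,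
    (∀ s ∈ L, s.M = 3 ∧ 0 < s.q ∧ s.q < 1 ∧ ∃ p t : ℝ, 0 < p ∧ p < 1 ∧ 0 < t ∧ t ≤ 1 ∧ s.ρ = CH[p, t] ∧
      2 ≤ s.q * (1 + p + p * t) ∧ x ≤ s.q * (p * t)) →
    ∀ P : List ℝ, (∀ γ ∈ P, 1 / 2 ≤ γ ∧ γ < 1 ∧ 3 * x ≤ 1 + 2 * γ) →
      ((∀ h, 0 ≤ lconv (3 * P.length) (ftop L) (cHub P) (flaw L) h) ∧
        (∀ h, 3 * P.length + ftop L < h → lconv (3 * P.length) (ftop L) (cHub P) (flaw L) h = 0) ∧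
        ∑ h ∈ Finset.range (3 * P.length + ftop L + 1), lconv (3 * P.length) (ftop L) (cHub P) (flaw L) h = 1 ∧
        ∑ h ∈ Finset.range (3 * P.length + ftop L + 1), (h : ℝ) * lconv (3 * P.length) (ftop L) (cHub P) (flaw L) h
          = (P.map (fun γ => 1 + 2 * γ)).sum + fmean L) ∧
      ((P.length ≠ 1 ∨ L ≠ []) → SDEC x (3 * P.length + ftop L) (lconv (3 * P.length) (ftop L) (cHub P) (flaw L))) ∧
      (∀ θ : ℝ, 2 / 3 ≤ θ → θ < 1 → x ≤ θ →
        SDEC x (3 * P.length + ftop L + 3) (lconv (3 * P.length + ftop L) 3 (lconv (3 * P.length) (ftop L) (cHub P) (flaw L)) (gate δ[3] θ))) ∧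
      (∀ θ : ℝ, 0 ≤ θ → θ ≤ 1 → 3 * x ≤ 2 + θ →
        SDEC x (3 * P.length + ftop L + 3) (lconv (3 * P.length + ftop L) 3 (lconv (3 * P.length) (ftop L) (cHub P) (flaw L)) HP[θ]))
  | [], _ => by
    intro P hP
    have hP01 : ∀ γ ∈ P, 0 ≤ γ ∧ γ ≤ 1 := fun γ h => ⟨by linarith [(hP γ h).1], (hP γ h).2.1.le⟩
    obtain ⟨a0, aM, a1, am⟩ := cHub_laws P hP01
    have eG : lconv (3 * P.length) (ftop []) (cHub P) (flaw []) = cHub P := by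
      funext h; exact lconv_delta_right _ _ _ aM h
    have eT : 3 * P.length + ftop [] = 3 * P.length := rfl
    rw [eG, eT]
    have hfm : fmean [] = 0 := rfl
    rw [hfm, add_zero]
    obtain ⟨hlo, _⟩ := farPieces_sum_bounds x P (fun γ h => ⟨(hP γ h).2.1, (hP γ h).2.2⟩)
    have hta : x * ((3 * P.length : ℕ) : ℝ) ≤ (P.map (fun γ => 1 + 2 * γ)).sum := by push_cast; linarith
    have c2 : (P.length ≠ 1 ∨ ([] : List Sib) ≠ []) → SDEC x (3 * P.length) (cHub P) := by
      intro hc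
      have hne : P.length ≠ 1 := by
        rcases hc with h | h
        · exact h
        · exact absurd rfl h
      rcases Nat.lt_or_ge P.length 2 with hlt | hge
      · have h0 : P.length = 0 := by omega
        rw [h0]
        intro q _ _ j' hj'
        omega
      · exact sdec_cHub hx0 P hge hP
    -- the lone far-giant piece
    have lone : P.length = 1 → ∃ γ, P = [γ] ∧ cHub [γ] = CP[γ] := by
      intro h1
      obtain ⟨γ, rfl⟩ : ∃ γ, P = [γ] := by
        rcases P with _ | ⟨γ, _ | ⟨γ', P'⟩⟩
        · simp at h1
        · exact ⟨γ, rfl⟩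
        · simp at h1
      have cpv : ∀ h, 3 < h → CP[γ] h = 0 := fun h hh => by
        simp only [show h ≠ 1 by omega, show h ≠ 3 by omega, if_false, mul_zero, add_zero]
      exact ⟨γ, rfl, funext fun h => lconv_delta_left 0 3 _ cpv h⟩
    refine ⟨⟨a0, aM, a1, am⟩, c2, fun θ hθ hθ1 hxθ => ?_, fun θ hθ0 hθ1 hxθ => ?_⟩
    · by_cases h1 : P.length = 1
      · obtain ⟨γ, rfl, e0⟩ := lone h1
        have hγ := hP γ (by simp)
        show SDEC x 6 (lconv 3 3 (cHub [γ]) (gate δ[3] θ))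
        rw [e0, farPieceBlob_eq_lconv]
        exact sdec_farPieceBlob hx0 hγ.1 hγ.2.1 hθ hθ1 hxθ hγ.2.2
      · exact (sdec_blob3_step hx0 hx1 hxθ hθ1.le a0 aM a1 am hta (c2 (Or.inl h1))).2.2.2.2
    · by_cases h1 : P.length = 1
      · obtain ⟨γ, rfl, e0⟩ := lone h1
        have hγ := hP γ (by simp)
        show SDEC x (3 + 3) (lconv 3 3 (cHub [γ]) HP[θ])
        rw [e0]
        exact isHigh_sdec hx0 hx1 (isHigh_farPieceHp (by linarith [hγ.1]) hγ.2.1.le hθ0 hθ1 (by linarith [hγ.2.2]))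
      · have h := sdec_lconv_high hx0 hx1 (isHigh_hp hθ0 hθ1 hxθ) a0 aM a1 (by rw [am]; exact hta) (c2 (Or.inl h1))
        rw [lconv_comm, Nat.add_comm] at h
        exact h
  | s :: L, hL => by
    intro P hP
    obtain ⟨hM, hq0, hq1, p, t, hp0, hp1, ht0, ht1, hρ, hm, hxc⟩ := hL s (by simp)
    have hL' : ∀ s' ∈ L, s'.M = 3 ∧ 0 < s'.q ∧ s'.q < 1 ∧ ∃ p t : ℝ, 0 < p ∧ p < 1 ∧ 0 < t ∧ t ≤ 1 ∧ s'.ρ = CH[p, t] ∧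
        2 ≤ s'.q * (1 + p + p * t) ∧ x ≤ s'.q * (p * t) := fun s' h' => hL s' (List.mem_cons_of_mem s h')
    obtain ⟨q, x₁, n, M, ρ⟩ := s
    simp only at hM hq0 hq1 hρ hm hxc
    subst hM
    subst hρ
    -- parameters of the 3-chain
    set m : ℝ := q * (1 + p + p * t) with hmdef
    set α : ℝ := 3 * (1 - q) / (3 - m) with hα
    set β' : ℝ := 2 * (1 - p) / (2 - p - p * t) with hβ'
    set γ : ℝ := (m - 1) / 2 with hγ
    set θ : ℝ := m - 2 with hθ
    obtain ⟨_, _, hα0, hα1, hβ0, hβ1, hβc, hm3, hm31, hγh, hγ1, hθ0, hθ1⟩ := chain3_params hq0 hq1 hp0 hp1 ht0 ht1 hm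
    have hx3 : 3 * x ≤ m := by
      have : 0 ≤ q * (1 + p - 2 * p * t) := mul_nonneg hq0.le (by nlinarith)
      nlinarith
    have hxγ : 3 * x ≤ 1 + 2 * γ := by rw [hγ]; linarith
    have hxm3 : x ≤ m / 3 := by linarith
    have hxθ : 3 * x ≤ 2 + θ := by rw [hθ]; linarith
    have hP01 : ∀ γ' ∈ P, 0 ≤ γ' ∧ γ' ≤ 1 := fun γ' h => ⟨by linarith [(hP γ' h).1], (hP γ' h).2.1.le⟩
    have hQ : ∀ γ' ∈ γ :: P, 1 / 2 ≤ γ' ∧ γ' < 1 ∧ 3 * x ≤ 1 + 2 * γ' := by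
      intro γ' h'
      rcases List.mem_cons.1 h' with rfl | h'
      · exact ⟨hγh, hγ1, hxγ⟩
      · exact hP γ' h'
    obtain ⟨⟨a0, aM, a1, am⟩, _, a3, a4⟩ := threeChain_inv hx0 hx1 L hL' P hP
    obtain ⟨⟨b0, bM, b1, bm⟩, b2, _, _⟩ := threeChain_inv hx0 hx1 L hL' (γ :: P) hQ
    obtain ⟨hft, hfm⟩ := threeChains_ftop_fmean L hL'
    obtain ⟨hlo, _⟩ := farPieces_sum_bounds x P (fun γ' h => ⟨(hP γ' h).2.1, (hP γ' h).2.2⟩)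
    set N : ℕ := 3 * P.length + ftop L with hN
    set G : ℕ → ℝ := lconv (3 * P.length) (ftop L) (cHub P) (flaw L) with hG
    set X₁ : ℕ → ℝ := lconv N 3 G (gate δ[3] (m / 3)) with hX₁
    set X₂ : ℕ → ℝ := lconv (3 * P.length + 3) (ftop L) (cHub (γ :: P)) (flaw L) with hX₂
    set X₃ : ℕ → ℝ := lconv N 3 G HP[θ] with hX₃
    set Y : ℕ → ℝ := fun h => β' * X₂ h + (1 - β') * X₃ h with hY
    have hsmean : Sib.mean ⟨q, x₁, n, 3, CH[p, t]⟩ = 1 + p + p * t := (chain3_laws hq0.le hq1.le hp0.le hp1.le ht0.le ht1).1.2.2.2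
    have eflaw : flaw (⟨q, x₁, n, 3, CH[p, t]⟩ :: L) = lconv (ftop L) 3 (flaw L) (gate CH[p, t] q) := rfl
    have eftop : ftop (⟨q, x₁, n, 3, CH[p, t]⟩ :: L) = ftop L + 3 := rfl
    have efmean : fmean (⟨q, x₁, n, 3, CH[p, t]⟩ :: L) = fmean L + q * (1 + p + p * t) := by
      show fmean L + q * Sib.mean ⟨q, x₁, n, 3, CH[p, t]⟩ = _; rw [hsmean]
    rw [eflaw, eftop, efmean]
    simp only [List.length_cons] at b0 bM b1 bm b2
    rw [show 3 * (P.length + 1) = 3 * P.length + 3 by ring] at b0 bM b1 bm b2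
    rw [show 3 * P.length + 3 + ftop L = N + 3 by rw [hN]; ring] at bM b1 bm b2
    -- the two-level mixture identity
    have hNP : ∀ k, NP[q, p, t] k = β' * CP[γ] k + (1 - β') * HP[θ] k := by
      intro k; rw [hβc]
    have hmixY : ∀ h, lconv N 3 G NP[q, p, t] h = Y h := by
      intro h
      rw [lconv_mix_right _ _ _ _ _ _ β' hNP h, hY, hX₂, hX₃, ← hubForest_piece P L γ]
    have hmix : ∀ h, lconv (3 * P.length) (ftop L + 3) (cHub P) (lconv (ftop L) 3 (flaw L) (gate CH[p, t] q)) h = α * X₁ h + (1 - α) * Y h := by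
      intro h
      rw [lconv_assoc, lconv_mix_right _ _ _ _ _ _ α (fun k => gate_chain3_eq_mix hq0 hq1 hp0 hp1 ht0.le ht1 k) h, hX₁, ← hmixY]
    have eNt : 3 * P.length + (ftop L + 3) = N + 3 := by rw [hN]; ring
    rw [eNt]
    -- laws of `X₁`, `X₃`
    obtain ⟨bl0, _, bl1, blm⟩ := blob3_laws (show (0 : ℝ) ≤ m / 3 by linarith) hm31.le
    obtain ⟨c0, cM, c1, cm⟩ := lconv_laws a0 a1 am bl0 bl1 blm
    obtain ⟨hp0', _, hp1', hpm⟩ := hp_laws hθ0 hθ1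
    obtain ⟨d0, dM, d1, dm⟩ := lconv_laws a0 a1 am hp0' hp1' hpm
    have hX₁s : SDEC x (N + 3) X₁ := a3 (m / 3) hm3 hm31 hxm3
    have hX₃s : SDEC x (N + 3) X₃ := a4 θ hθ0 hθ1 hxθ
    have cm' : ∑ h ∈ Finset.range (N + 3 + 1), (h : ℝ) * X₁ h = (P.map (fun γ => 1 + 2 * γ)).sum + (fmean L + q * (1 + p + p * t)) := by
      rw [hX₁, cm]; rw [hmdef]; ring
    have dm' : ∑ h ∈ Finset.range (N + 3 + 1), (h : ℝ) * X₃ h = (P.map (fun γ => 1 + 2 * γ)).sum + (fmean L + q * (1 + p + p * t)) := by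
      rw [hX₃, dm]; try rw [hθ]
      try rw [hmdef]
      ring
    have bm' : ∑ h ∈ Finset.range (N + 3 + 1), (h : ℝ) * X₂ h = (P.map (fun γ => 1 + 2 * γ)).sum + (fmean L + q * (1 + p + p * t)) := by
      rw [hX₂, bm]; simp only [List.map_cons, List.sum_cons]; rw [hγ, hmdef]; ring
    have main : ((∀ h, 0 ≤ lconv (3 * P.length) (ftop L + 3) (cHub P) (lconv (ftop L) 3 (flaw L) (gate CH[p, t] q)) h) ∧
        (∀ h, N + 3 < h → lconv (3 * P.length) (ftop L + 3) (cHub P) (lconv (ftop L) 3 (flaw L) (gate CH[p, t] q)) h = 0) ∧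
        ∑ h ∈ Finset.range (N + 3 + 1), lconv (3 * P.length) (ftop L + 3) (cHub P) (lconv (ftop L) 3 (flaw L) (gate CH[p, t] q)) h = 1 ∧
        ∑ h ∈ Finset.range (N + 3 + 1), (h : ℝ) * lconv (3 * P.length) (ftop L + 3) (cHub P) (lconv (ftop L) 3 (flaw L) (gate CH[p, t] q)) h
          = (P.map (fun γ => 1 + 2 * γ)).sum + (fmean L + q * (1 + p + p * t))) ∧
        SDEC x (N + 3) (lconv (3 * P.length) (ftop L + 3) (cHub P) (lconv (ftop L) 3 (flaw L) (gate CH[p, t] q))) := by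
      by_cases hcorner : P = [] ∧ L = []
      · -- one 3-chain alone: `sdec_chain3`
        obtain ⟨rfl, rfl⟩ := hcorner
        obtain ⟨t0, tM, t1, tm⟩ := (chain3_laws hq0.le hq1.le hp0.le hp1.le ht0.le ht1).2
        have e1 : lconv (ftop []) 3 (flaw []) (gate CH[p, t] q) = gate CH[p, t] q := funext fun h => lconv_delta_left 0 3 _ tM h
        have e2 : lconv (3 * ([] : List ℝ).length) (ftop [] + 3) (cHub []) (gate CH[p, t] q) = gate CH[p, t] q :=
          funext fun h => lconv_delta_left 0 3 _ tM h
        have hN3 : N + 3 = 3 := by rw [hN]; rfl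
        rw [e1, e2, hN3]
        refine ⟨⟨t0, tM, t1, by rw [tm]; simp [fmean]⟩, ?_⟩
        rcases ht1.lt_or_eq with ht1' | ht1'
        · exact sdec_chain3 hq0 hq1 hp0 hp1 ht0 ht1' hxc
        · -- `t = 1`: the 3-chain is the glued child `R[q](R²[p])`
          subst ht1'
          have e : CH[p, (1 : ℝ)] = CP[p] := by funext h; simp only [sub_self, mul_zero, zero_mul, add_zero, mul_one]
          rw [e]
          exact sdec_gluedChild hq0 hq1 hp0 hp1 (by simpa using hxc)
      · have hcond : (γ :: P).length ≠ 1 ∨ L ≠ [] := by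
          by_cases hPn : P = []
          · exact Or.inr (fun hLn => hcorner ⟨hPn, hLn⟩)
          · left; simp only [List.length_cons]; intro h; exact hPn (List.length_eq_zero_iff.1 (by omega))
        have hX₂s : SDEC x (N + 3) X₂ := b2 hcond
        obtain ⟨y0, yM, y1, ym, yS⟩ := sdec_mix_laws (μ := Y) hβ0 hβ1 (fun h => by rw [hY]) b0 bM b1 bm' d0 dM d1 dm' hX₂s hX₃s
        obtain ⟨r0, rM, r1, rm, rS⟩ := sdec_mix_laws hα0 hα1 hmix c0 cM c1 cm' y0 yM y1 ym hX₁s yS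
        exact ⟨⟨r0, rM, r1, rm⟩, rS⟩
    obtain ⟨⟨r0, rM, r1, rm⟩, rS⟩ := main
    have hta : x * ((N + 3 : ℕ) : ℝ) ≤ (P.map (fun γ => 1 + 2 * γ)).sum + (fmean L + q * (1 + p + p * t)) := by
      rw [hN]; push_cast
      have h1 : x * ((ftop L : ℕ) : ℝ) ≤ fmean L := hfm
      have h2 : 3 * x ≤ q * (1 + p + p * t) := by rw [← hmdef]; exact hx3
      have e : x * (3 * (P.length : ℝ) + (ftop L : ℕ) + 3) = 3 * x * (P.length : ℝ) + x * ((ftop L : ℕ) : ℝ) + 3 * x := by ring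
      rw [e]
      linarith [hlo, h1, h2]
    refine ⟨⟨r0, rM, r1, rm⟩, fun _ => rS, fun θ' hθ' hθ'1 hxθ' => ?_, fun θ' hθ'0 hθ'1 hxθ' => ?_⟩
    · exact (sdec_blob3_step hx0 hx1 hxθ' hθ'1.le r0 rM r1 rm hta rS).2.2.2.2
    · have h := sdec_lconv_high hx0 hx1 (isHigh_hp hθ'0 hθ'1 hxθ') r0 rM r1 (by rw [rm]; exact hta) rS
      rw [lconv_comm, Nat.add_comm] at h
      exact h

/-- **EVERY FOREST OF 3-CHAINS (AND GLUED CHILDREN), EVERY WIDTH, IS SDEC AT THE TRUE FLOOR — ORACLE-FREE.**  For every list of siblings each of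
which is a 3-chain `R[qᵢ](R[pᵢ](R[tᵢ]))` (`ρᵢ = {1: 1−pᵢ, 2: pᵢ(1−tᵢ), 3: pᵢtᵢ}`, `0 < qᵢ, pᵢ < 1`, `0 < tᵢ ≤ 1` — `tᵢ = 1` is the glued child
`R[qᵢ](R²[pᵢ])` —, `mᵢ = qᵢ(1 + pᵢ + pᵢtᵢ) ≥ 2`) and every floor `0 < x ≤ min qᵢpᵢtᵢ`: `SDEC x (ftop L) (flaw L)`.  (Widths 2, 3: census-1 g30
`sdec_chains2/3`, `sdec_gluedChildren2/3`.) [this work] -/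
theorem sdec_threeChain_forest {x : ℝ} (hx0 : 0 < x) (L : List Sib)
    (hL : ∀ s ∈ L, s.M = 3 ∧ 0 < s.q ∧ s.q < 1 ∧ ∃ p t : ℝ, 0 < p ∧ p < 1 ∧ 0 < t ∧ t ≤ 1 ∧ s.ρ = CH[p, t] ∧
      2 ≤ s.q * (1 + p + p * t) ∧ x ≤ s.q * (p * t)) :
    SDEC x (ftop L) (flaw L) := by
  by_cases hnil : L = []
  · subst hnil; intro q _ _ j' hj'; exact absurd hj' (Nat.not_lt_zero _)
  · obtain ⟨s, hs⟩ := List.exists_mem_of_ne_nil L hnil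
    have hx1 : x < 1 := by
      obtain ⟨_, hq0, hq1, p, t, hp0, hp1, ht0, ht1, _, _, hx⟩ := hL s hs
      have : p * t ≤ p := by nlinarith
      nlinarith
    have hLaw : ∀ s ∈ L, s.LawOK := by
      intro s hs
      obtain ⟨hM, hq0, hq1, p, t, hp0, hp1, ht0, ht1, hρ, _, _⟩ := hL s hs
      obtain ⟨c0, cM, c1, _⟩ := (chain3_laws hq0.le hq1.le hp0.le hp1.le ht0.le ht1).1
      refine ⟨hq0, hq1, ?_, ?_, ?_⟩
      · intro h; rw [hρ]; exact c0 h
      · intro h hh; rw [hρ]; exact cM h (by rw [hM] at hh; exact hh)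
      · rw [hM, hρ]; exact c1
    obtain ⟨_, fM, _, _⟩ := flaw_facts L hLaw
    have h := (threeChain_inv hx0 hx1 L hL [] (fun γ h => by simp at h)).2.1 (Or.inl (by simp))
    have e : lconv (3 * ([] : List ℝ).length) (ftop L) (cHub []) (flaw L) = flaw L := funext fun k => lconv_delta_left _ _ _ fM k
    rw [e] at h
    simpa using h

end LawDec
end Quant
end Summit.CriticalPhenomena.PercolationContinuityZ3.Theorems
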